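import Summits.BirchSwinnertonDyer.BirchSwinnertonDyer.Theses.ResidualThetaTransportAtTwo
import Summits.BirchSwinnertonDyer.BirchSwinnertonDyer.Theorems.ResidualThetaTransportAtTwoSignedMuVanishingAtTwoPlusAnalyticAtW
import Literature.NumberTheory.EllipticCurves.KatoRankBoundProofs
import HarnessLib

/-!
# Route `ResidualThetaTransportAtTwo`, crux Kμ⁺ (stmt-BirchSwinnertonDyer-20689): the analytic child
# `SignedMuAnalyticAtTwoPlus` (stmt-21437) is EXACTLY "period unit + `2 ∤ L♭_f`"

Lead line `birth`, seat bsd-wall-rtt-p4 (helper for the reshaped stubs `stub_periodUnitAtTwo`,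
`stub_flatMuZeroAtTwo`; nothing about any curve is asserted, BSD is not proved by this).
The two hypotheses are spelled inline (no new definitions):
* (PER) on the habitat, `Ω_W = u · Ω⁺_f` with `|u|₂ = 1` for the newform `f` of `W` — the conclusion
  of the tree fact `realPeriodRat_eq_unit_mul_plusPeriod_two`, PROVED here modulo the one print fact
  `abbesUllmo_not_dvd_maninConstant_of_not_dvd_level` (Abbes–Ullmo 1996 Thm. A) by
  `SignedMuAtTwo.exists_periodUnit_two_of_abbesUllmo`;
* (FLAT) on the habitat⁺, `2 ∤ L♭` for every Pollack pair `(L♯, L♭)` at `2` of the newform of `W`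
  (`μ(L♭_f) = 0`; research residue, per-class certifiable by one odd plus modular symbol).
Theorems: `signedMuAnalyticAtTwoPlus_of_periodUnit_of_flatMuZero` — (PER) ∧ (FLAT) ⇒ the child;
`signedMuAnalyticAtTwoPlus_of_abbesUllmo_of_flatMuZero` — Abbes–Ullmo ∧ (FLAT) ⇒ the child;
`flatMuZero_of_signedMuAnalyticAtTwoPlus_of_periodUnit` — the child ∧ (PER) ⇒ (FLAT) (take `m = 0`,
`G = C(ϖ)·L♭`); so GRANTED Abbes–Ullmo the child and (FLAT) are equivalent
(`signedMuAnalyticAtTwoPlus_iff_flatMuZero_of_abbesUllmo`).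
[cite: Pollack2003, Prop. 6.18] [cite: AbbesUllmo1996, Thm. A] [cite: GreenbergVatsal2000, §3, Remark 3.4]
-/

set_option autoImplicit false
set_option linter.dupNamespace false

noncomputable section

open scoped Classical MatrixGroups ModularForm

open CongruenceSubgroup WeierstrassCurve Literature.NumberTheory.EllipticCurves
  Literature.NumberTheory.EllipticCurves.ModularForms Literature.NumberTheory.EllipticCurves.Rank1Residual
  Summit.BirchSwinnertonDyer.Rank1Residual.Supersingular Summit.BirchSwinnertonDyer.Rank1Residual.X1
  Summit.BirchSwinnertonDyer.BirchSwinnertonDyer.Theses.ResidualThetaTransportAtTwo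

namespace Summit.BirchSwinnertonDyer.BirchSwinnertonDyer.Theorems

/-- **(PER) ∧ (FLAT) ⇒ the analytic child of Kμ⁺**: if on the habitat the Néron period is a `2`-adic
unit multiple of `Ω⁺_f`, and `2 ∤ L♭` for every Pollack pair at `2` of the newform of a habitat⁺ curve,
then `SignedMuAnalyticAtTwoPlus` holds (`μ(G) = m` whenever `ι G = 2^m ϖ ι L⁺_W`).
[cite: Pollack2003, Prop. 6.18] [cite: GreenbergVatsal2000, §3, Remark 3.4] -/
theorem signedMuAnalyticAtTwoPlus_of_periodUnit_of_flatMuZero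
    (hper : ∀ (W : WeierstrassCurve ℚ) [W.IsElliptic] [W.IsGloballyMinimal], GoodSS W 2 →
      ∀ [NeZero (W.conductorNorm ℤ)] (f : CuspForm (Gamma0 (W.conductorNorm ℤ)) 2), IsNewformOf W f →
      ∃ u : ℚ, ‖(u : ℚ_[2])‖ = 1 ∧ W.realPeriodRat = u * plusPeriod f)
    (hflat : ∀ (W : WeierstrassCurve ℚ) [W.IsElliptic] [W.IsGloballyMinimal], ¬ W.HasCM →
      W.analyticRank = 0 → GoodSS W 2 → W.frobeniusTrace 2 = 0 → W.Δ < 0 →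
      ∀ [NeZero (W.conductorNorm ℤ)] (f : CuspForm (Gamma0 (W.conductorNorm ℤ)) 2), IsNewformOf W f →
      ∀ (Lplus Lminus : IwasawaAlgebra 2), IsPollackPair f 2 Lplus Lminus →
      ¬ PowerSeries.C (2 : ℤ_[2]) ∣ Lminus) :
    SignedMuAnalyticAtTwoPlus := by
  intro W _ _ hCM hr hss ha hΔ γ _ _ f hf ϖ hϖ Lplus Lminus hP G m hG
  exact SignedMuAtTwo.mu_eq_of_isPollackPair_two_of_periodUnit_of_not_two_dvd hϖ (hper W hss f hf)
    (hflat W hCM hr hss ha hΔ f hf Lplus Lminus hP) G m hG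

/-- **GRANTED Abbes–Ullmo, (FLAT) ⇒ the analytic child of Kμ⁺.** [cite: AbbesUllmo1996, Thm. A]
[cite: Pollack2003, Prop. 6.18] -/
theorem signedMuAnalyticAtTwoPlus_of_abbesUllmo_of_flatMuZero
    (hAU : abbesUllmo_not_dvd_maninConstant_of_not_dvd_level)
    (hflat : ∀ (W : WeierstrassCurve ℚ) [W.IsElliptic] [W.IsGloballyMinimal], ¬ W.HasCM →
      W.analyticRank = 0 → GoodSS W 2 → W.frobeniusTrace 2 = 0 → W.Δ < 0 →
      ∀ [NeZero (W.conductorNorm ℤ)] (f : CuspForm (Gamma0 (W.conductorNorm ℤ)) 2), IsNewformOf W f →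
      ∀ (Lplus Lminus : IwasawaAlgebra 2), IsPollackPair f 2 Lplus Lminus →
      ¬ PowerSeries.C (2 : ℤ_[2]) ∣ Lminus) :
    SignedMuAnalyticAtTwoPlus :=
  signedMuAnalyticAtTwoPlus_of_periodUnit_of_flatMuZero
    (fun _ _ _ hss _ _ hf ↦ SignedMuAtTwo.exists_periodUnit_two_of_abbesUllmo hAU hss hf) hflat

/-- **The child ∧ (PER) ⇒ (FLAT)**: apply the child to `m = 0`, `G = C(ϖ) · L♭ ∈ Λ` (`ϖ = u⁻¹` is a
`2`-adic unit) at a cyclotomic variable `γ` (`exists_isCyclotomic_isTopGenerator_isCyclotomicVariable`),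
and read `μ(G) = 0` back as `2 ∤ L♭` (`not_two_dvd_iff_mu_eq_of_isPollackPair_two_of_periodUnit`).
[cite: Pollack2003, Prop. 6.18] [cite: GreenbergVatsal2000, §3, Remark 3.4] -/
theorem flatMuZero_of_signedMuAnalyticAtTwoPlus_of_periodUnit (h : SignedMuAnalyticAtTwoPlus)
    (hper : ∀ (W : WeierstrassCurve ℚ) [W.IsElliptic] [W.IsGloballyMinimal], GoodSS W 2 →
      ∀ [NeZero (W.conductorNorm ℤ)] (f : CuspForm (Gamma0 (W.conductorNorm ℤ)) 2), IsNewformOf W f →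
      ∃ u : ℚ, ‖(u : ℚ_[2])‖ = 1 ∧ W.realPeriodRat = u * plusPeriod f) :
    ∀ (W : WeierstrassCurve ℚ) [W.IsElliptic] [W.IsGloballyMinimal], ¬ W.HasCM →
      W.analyticRank = 0 → GoodSS W 2 → W.frobeniusTrace 2 = 0 → W.Δ < 0 →
      ∀ [NeZero (W.conductorNorm ℤ)] (f : CuspForm (Gamma0 (W.conductorNorm ℤ)) 2), IsNewformOf W f →
      ∀ (Lplus Lminus : IwasawaAlgebra 2), IsPollackPair f 2 Lplus Lminus →
      ¬ PowerSeries.C (2 : ℤ_[2]) ∣ Lminus := by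
  intro W _ _ hCM hr hss ha hΔ _ f hf Lplus Lminus hP
  obtain ⟨κ, -, γ, -, hγ'⟩ := exists_isCyclotomic_isTopGenerator_isCyclotomicVariable_holds 2
  have hu := hper W hss f hf
  obtain ⟨u, hu1, hΩ⟩ := hu
  have hΩpos : 0 < W.realPeriodRat := W.realPeriodRat_pos_holds
  have hu0 : u ≠ 0 := by rintro rfl; simp at hu1
  have hu0' : (u : ℝ) ≠ 0 := by exact_mod_cast hu0
  -- the period ratio `ϖ = u⁻¹`
  have hϖ : ((u⁻¹ : ℚ) : ℝ) * W.realPeriodRat = plusPeriod f := by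
    rw [hΩ, Rat.cast_inv, ← mul_assoc, inv_mul_cancel₀ hu0', one_mul]
  have hϖ1 : ‖((u⁻¹ : ℚ) : ℚ_[2])‖ = 1 := by rw [Rat.cast_inv, norm_inv, hu1, inv_one]
  obtain ⟨w, hw⟩ := SignedMuAtTwo.exists_units_coe_eq_of_norm_ratCast_eq_one (p := 2) hϖ1
  -- `G = C(w) · L♭`, `m = 0`
  have hk : kobayashiL (p := 2) 1 Lplus Lminus = Lminus := by unfold kobayashiL; rw [if_pos rfl]
  have hG : iwasawaToPowerSeries 2 (PowerSeries.C (w : ℤ_[2]) * Lminus) =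
      PowerSeries.C ((2 : ℚ_[2]) ^ 0 * ((u⁻¹ : ℚ) : ℚ_[2])) *
        iwasawaToPowerSeries 2 (kobayashiL 1 Lplus Lminus) := by
    rw [hk, map_mul, pow_zero, one_mul, ← hw]
    congr 1
    simp [iwasawaToPowerSeries]
  have hμ := h W hCM hr hss ha hΔ γ hγ' f hf (u⁻¹) hϖ Lplus Lminus hP _ 0 hG
  exact (SignedMuAtTwo.not_two_dvd_iff_mu_eq_of_isPollackPair_two_of_periodUnit hϖ ⟨u, hu1, hΩ⟩ hP
    _ 0 hG).mpr hμ

/-- **GRANTED Abbes–Ullmo, the analytic child of Kμ⁺ IS the residue (FLAT)** `2 ∤ L♭_f` on the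
habitat⁺. [cite: AbbesUllmo1996, Thm. A] [cite: Pollack2003, Prop. 6.18] -/
theorem signedMuAnalyticAtTwoPlus_iff_flatMuZero_of_abbesUllmo
    (hAU : abbesUllmo_not_dvd_maninConstant_of_not_dvd_level) :
    SignedMuAnalyticAtTwoPlus ↔
      ∀ (W : WeierstrassCurve ℚ) [W.IsElliptic] [W.IsGloballyMinimal], ¬ W.HasCM →
        W.analyticRank = 0 → GoodSS W 2 → W.frobeniusTrace 2 = 0 → W.Δ < 0 →
        ∀ [NeZero (W.conductorNorm ℤ)] (f : CuspForm (Gamma0 (W.conductorNorm ℤ)) 2), IsNewformOf W f →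
        ∀ (Lplus Lminus : IwasawaAlgebra 2), IsPollackPair f 2 Lplus Lminus →
        ¬ PowerSeries.C (2 : ℤ_[2]) ∣ Lminus :=
  ⟨fun h ↦ flatMuZero_of_signedMuAnalyticAtTwoPlus_of_periodUnit h
      (fun _ _ _ hss _ _ hf ↦ SignedMuAtTwo.exists_periodUnit_two_of_abbesUllmo hAU hss hf),
    signedMuAnalyticAtTwoPlus_of_abbesUllmo_of_flatMuZero hAU⟩

end Summit.BirchSwinnertonDyer.BirchSwinnertonDyer.Theorems

end
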